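import Summits.Ventures.PercRepro.SixFourResidueFourPlaneLineXbarC

/-!
# PercRepro — C-025 at `(6,4)`: the plane-line branch (γ) at `t = 4`, part 3 — Lemma TW (p5, gen 10; lead (nn))

mine-2's Lemma TW (§21.18.7): on a plane-line solid with every plane trace of `≤ g − 3` points,

  `J₄ ≥ T⁺(g, p) + Σ_j w′_j − (12/5)·2^{n+e}·[a covering pair]`,   `w′_j := T⁺(g, n + s_j) − (12/5)·2^{s_j} − (48/5)·n`,

with `T⁺(g, q) = C(q,2)·min_{2 ≤ m ≤ q − 1} L(g,q,m)/C(m,2) − base(g,q)` (`Tplus`) — from the plane inventory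
(`J_four_ge_inventory`), the quantitative per-plane bound (`slack4_ge_of_mu`: `slack4 ≥ T⁺` on every rank-`3`
trace, `slack4_ge_Tplus`) and Lemma X̄′ (`Xcnt_le_planeLine`; its `2n·(#classes + 1)` is at most
`4n·#classes`).  **`J_four_ge_TW`** is the theorem; the structural facts the numerics use are
`sum_card_classes'` (`Σ_C |C| = p − e + e·#classes`), `card_class_le` (`1 + e ≤ |C| ≤ p − 3`) and
`coverPairs_card_classes` (a covering pair forces exactly two classes with `|C₁| + |C₂| = p + e`).

The sharper form **`J_four_ge_TW'`** keeps Lemma X̄′'s constant (`(24/5)·n` per class and once more overall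
instead of `(48/5)·n` per class); the numeric clauses and the reduction of `PlaneLineFourBig` to them are in
`SixFourResidueFourPlaneLineClauses.lean`.
-/

namespace PercRepro.SixFour

open Finset ThmH

variable {α : Type*} [DecidableEq α] {M : Matroid α} [M.Finite] {G : Finset α}

/-! ## `T⁺` -/

/-- **`T⁺(g, q) = C(q,2)·min_{2 ≤ m ≤ q−1} L(g,q,m)/C(m,2) − base(g,q)`** (mine-2's §21.13.3; `0` for `q ≤ 2`). -/
noncomputable def Tplus (g q : ℕ) : ℚ :=
  if h : 3 ≤ q then
    (q.choose 2 : ℚ) * ((Finset.Icc 2 (q - 1)).inf' ⟨2, by rw [Finset.mem_Icc]; omega⟩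
      fun m => Lterm4 g q m / (m.choose 2 : ℚ)) - base4 g q
  else 0

/-- `T⁺` for `q ≥ 3`. -/
theorem Tplus_of_three_le {g q : ℕ} (hq : 3 ≤ q) :
    Tplus g q = (q.choose 2 : ℚ) * ((Finset.Icc 2 (q - 1)).inf' ⟨2, by rw [Finset.mem_Icc]; omega⟩
      fun m => Lterm4 g q m / (m.choose 2 : ℚ)) - base4 g q := by
  unfold Tplus
  rw [dif_pos hq]

/-- **`slack4 ≥ T⁺` on every rank-`3` plane trace.** -/
theorem slack4_ge_Tplus (hs : Simple M) (hG : G ⊆ gr M) {P : Finset α}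
    (hr : M.eRk ((P ∩ G : Finset α) : Set α) = 3) : Tplus G.card (P ∩ G).card ≤ slack4 M G P := by
  have hq := three_le_card_of_eRk_eq_three hr
  rw [Tplus_of_three_le hq]
  set q := (P ∩ G).card with hq'
  set μ := (Finset.Icc 2 (q - 1)).inf' ⟨2, by rw [Finset.mem_Icc]; omega⟩
    fun m => Lterm4 G.card q m / (m.choose 2 : ℚ) with hμ
  refine slack4_ge_of_mu hs hG hr μ fun m hm2 hmq => ?_
  have hmem : m ∈ Finset.Icc 2 (q - 1) := by rw [Finset.mem_Icc]; omega
  have hle : μ ≤ Lterm4 G.card q m / (m.choose 2 : ℚ) := Finset.inf'_le _ hmem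
  have hpos : (0 : ℚ) < (m.choose 2 : ℚ) := by
    have : 0 < m.choose 2 := Nat.choose_pos (by omega)
    exact_mod_cast this
  rw [le_div_iff₀ hpos] at hle
  exact hle

/-! ## Lemma TW -/

/-- **`w′(g, n, s) = T⁺(g, n + s) − (12/5)·2^s − (48/5)·n`**, the class term of Lemma TW. -/
noncomputable def wprime (g n s : ℕ) : ℚ := Tplus g (n + s) - 12 / 5 * (2 : ℚ) ^ s - 48 / 5 * (n : ℚ)

namespace PLData

variable {D : PLData M G}

/-- `Σ_C |C| = (p − e) + e·#classes`. -/
theorem sum_card_classes' (hs : Simple M) (hG : G ⊆ gr M) (h2 : 2 ≤ D.L.card) :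
    ∑ C ∈ D.classes, C.card = (D.ρ.card - (D.ellF ∩ D.ρ).card) + (D.ellF ∩ D.ρ).card * D.classes.card := by
  have h := sum_card_classes (D := D) hs hG h2
  have hterm : ∀ C ∈ D.classes, C.card = (C.card - (D.ellF ∩ D.ρ).card) + (D.ellF ∩ D.ρ).card := by
    intro C hC
    have := one_le_card_class hC hs hG h2
    omega
  rw [Finset.sum_congr rfl hterm, Finset.sum_add_distrib, h, Finset.sum_const, smul_eq_mul, mul_comm]

/-- `1 + e ≤ |C| ≤ p − 3` for every class. -/
theorem card_class_le (hs : Simple M) (hG : G ⊆ gr M) (h2 : 2 ≤ D.L.card)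
    (hpl : ∀ P ∈ planes M, (P ∩ G).card + 3 ≤ G.card) {C : Finset α} (hC : C ∈ D.classes) :
    (D.ellF ∩ D.ρ).card + 1 ≤ C.card ∧ C.card + 3 ≤ D.ρ.card := by
  refine ⟨one_le_card_class hC hs hG h2, ?_⟩
  have h3 := three_le_card_sdiff_class hs hG h2 hpl hC
  have hCρ : C ⊆ D.ρ := (classes_facts hC hs hG h2).1
  have := Finset.card_sdiff_add_card_eq_card hCρ
  omega

/-- **A covering pair forces exactly two classes, of sizes summing to `p + e`.** -/
theorem coverPairs_card_classes (hs : Simple M) (hG : G ⊆ gr M) (h2 : 2 ≤ D.L.card)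
    (hne : D.coverPairs.Nonempty) :
    D.classes.card = 2 ∧ ∃ A ∈ D.classes, ∃ B ∈ D.classes, A ≠ B ∧ D.classes = {A, B} ∧
      A.card + B.card = D.ρ.card + (D.ellF ∩ D.ρ).card := by
  obtain ⟨⟨A, B⟩, hAB⟩ := hne
  unfold coverPairs at hAB
  rw [Finset.mem_filter, Finset.mem_product] at hAB
  obtain ⟨⟨hA, hB⟩, hne', hcov⟩ := hAB
  have hclasses : D.classes = {A, B} := by
    ext K
    rw [Finset.mem_insert, Finset.mem_singleton]
    constructor
    · intro hK
      exact classes_eq_of_cover hs hG h2 hA hB hcov hK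
    · rintro (rfl | rfl)
      · exact hA
      · exact hB
  have hcard : D.classes.card = 2 := by
    rw [hclasses, Finset.card_insert_of_notMem (by rwa [Finset.mem_singleton]), Finset.card_singleton]
  refine ⟨hcard, A, hA, B, hB, hne', hclasses, ?_⟩
  -- `|A ∪ B| = p` (they cover `ρ` and lie in it) and `|A ∩ B| = e`
  have hAρ : A ⊆ D.ρ := (classes_facts hA hs hG h2).1
  have hBρ : B ⊆ D.ρ := (classes_facts hB hs hG h2).1
  have hunion : A ∪ B = D.ρ := Finset.Subset.antisymm (Finset.union_subset hAρ hBρ) hcov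
  have hinter : A ∩ B = D.ellF ∩ D.ρ := by
    apply Finset.Subset.antisymm (classes_inter_subset hs hG h2 hA hB hne')
    intro z hz
    exact Finset.mem_inter.2 ⟨ellF_inter_ρ_subset_class hA hz, ellF_inter_ρ_subset_class hB hz⟩
  have := Finset.card_union_add_card_inter A B
  rw [hunion, hinter] at this
  omega

/-- **LEMMA TW**: `T⁺(g,p) + Σ_C w′(g, n, |C|) − (12/5)·2^{n+e}·[covering pair] ≤ J₄(G)` on every plane-line
normalisation of a rank-`4` set with plane traces `≤ g − 3` and `g ≥ 10`. -/
theorem J_four_ge_TW (hs : Simple M) (hG : G ⊆ gr M) (hr : M.eRk (G : Set α) = 4)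
    (hpl : ∀ P ∈ planes M, (P ∩ G).card + 3 ≤ G.card) (hg : 10 ≤ G.card) :
    Tplus G.card D.ρ.card + ∑ C ∈ D.classes, wprime G.card D.L.card C.card -
      12 / 5 * (2 : ℚ) ^ (D.L.card + (D.ellF ∩ D.ρ).card) * (if D.coverPairs.Nonempty then 1 else 0) ≤
      J M G 4 := by
  have h3 : 3 ≤ D.L.card := three_le_card_L' (D := D) (hpl _ D.plane)
  have h2 : 2 ≤ D.L.card := by omega
  -- the inventory and the covering count
  have hinv := J_four_ge_inventory (D := D) hs hG hr hpl hg
  have hX := Xcnt_le_planeLine (D := D) hs hG hr hpl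
  have hXq : (Xcnt M G : ℚ) ≤ 2 * (∑ C ∈ D.classes, (2 : ℚ) ^ C.card + 2 * D.L.card * D.classes.card +
      2 * D.L.card) + 2 * (2 : ℚ) ^ (D.L.card + (D.ellF ∩ D.ρ).card) *
        (if D.coverPairs.Nonempty then 1 else 0) := by
    have := (Nat.cast_le (α := ℚ)).2 hX
    push_cast at this
    split_ifs at this ⊢ <;> linarith
  -- the per-plane bounds
  have hP₀ : Tplus G.card D.ρ.card ≤ slack4 M G D.P₀ := slack4_ge_Tplus hs hG D.rank_trace
  have hclass : ∀ C ∈ D.classes, Tplus G.card (D.L.card + C.card) ≤ slack4 M G (D.PiC C) := by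
    intro C hC
    have := slack4_ge_Tplus hs hG (PiC_facts hs hG h2 hC).2.1
    rwa [card_PiC_inter_G hs hG h2 hC] at this
  have hsum : ∑ C ∈ D.classes, Tplus G.card (D.L.card + C.card) ≤ ∑ C ∈ D.classes, slack4 M G (D.PiC C) :=
    Finset.sum_le_sum hclass
  -- `#classes ≥ 1`
  have hcl : 1 ≤ D.classes.card := Finset.card_pos.2 (classes_nonempty hs hG h2)
  have hclq : (1 : ℚ) ≤ D.classes.card := by exact_mod_cast hcl
  -- assemble
  have hw : ∑ C ∈ D.classes, wprime G.card D.L.card C.card =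
      ∑ C ∈ D.classes, Tplus G.card (D.L.card + C.card) - 12 / 5 * ∑ C ∈ D.classes, (2 : ℚ) ^ C.card -
        48 / 5 * (D.L.card : ℚ) * D.classes.card := by
    unfold wprime
    rw [Finset.sum_sub_distrib, Finset.sum_sub_distrib, Finset.mul_sum, Finset.sum_const, nsmul_eq_mul]
    ring
  rw [hw]
  have hn : (0 : ℚ) ≤ D.L.card := by positivity
  nlinarith [hinv, hXq, hP₀, hsum, hclq, hn]

/-- **`w♯(g, n, s) = T⁺(g, n + s) − (12/5)·2^s − (24/5)·n`**, the class term with Lemma X̄′'s own constant. -/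
noncomputable def _root_.PercRepro.SixFour.wsharp (g n s : ℕ) : ℚ :=
  Tplus g (n + s) - 12 / 5 * (2 : ℚ) ^ s - 24 / 5 * (n : ℚ)

/-- **LEMMA TW, sharp form**: `T⁺(g,p) − (24/5)·n + Σ_C w♯(g, n, |C|) − (12/5)·2^{n+e}·[covering pair] ≤ J₄(G)`. -/
theorem J_four_ge_TW' (hs : Simple M) (hG : G ⊆ gr M) (hr : M.eRk (G : Set α) = 4)
    (hpl : ∀ P ∈ planes M, (P ∩ G).card + 3 ≤ G.card) (hg : 10 ≤ G.card) :
    Tplus G.card D.ρ.card - 24 / 5 * (D.L.card : ℚ) + ∑ C ∈ D.classes, wsharp G.card D.L.card C.card -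
      12 / 5 * (2 : ℚ) ^ (D.L.card + (D.ellF ∩ D.ρ).card) * (if D.coverPairs.Nonempty then 1 else 0) ≤
      J M G 4 := by
  have h3 : 3 ≤ D.L.card := three_le_card_L' (D := D) (hpl _ D.plane)
  have h2 : 2 ≤ D.L.card := by omega
  have hinv := J_four_ge_inventory (D := D) hs hG hr hpl hg
  have hX := Xcnt_le_planeLine (D := D) hs hG hr hpl
  have hXq : (Xcnt M G : ℚ) ≤ 2 * (∑ C ∈ D.classes, (2 : ℚ) ^ C.card + 2 * D.L.card * D.classes.card +
      2 * D.L.card) + 2 * (2 : ℚ) ^ (D.L.card + (D.ellF ∩ D.ρ).card) *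
        (if D.coverPairs.Nonempty then 1 else 0) := by
    have := (Nat.cast_le (α := ℚ)).2 hX
    push_cast at this
    split_ifs at this ⊢ <;> linarith
  have hP₀ : Tplus G.card D.ρ.card ≤ slack4 M G D.P₀ := slack4_ge_Tplus hs hG D.rank_trace
  have hclass : ∀ C ∈ D.classes, Tplus G.card (D.L.card + C.card) ≤ slack4 M G (D.PiC C) := by
    intro C hC
    have := slack4_ge_Tplus hs hG (PiC_facts hs hG h2 hC).2.1
    rwa [card_PiC_inter_G hs hG h2 hC] at this
  have hsum : ∑ C ∈ D.classes, Tplus G.card (D.L.card + C.card) ≤ ∑ C ∈ D.classes, slack4 M G (D.PiC C) :=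
    Finset.sum_le_sum hclass
  have hw : ∑ C ∈ D.classes, wsharp G.card D.L.card C.card =
      ∑ C ∈ D.classes, Tplus G.card (D.L.card + C.card) - 12 / 5 * ∑ C ∈ D.classes, (2 : ℚ) ^ C.card -
        24 / 5 * (D.L.card : ℚ) * D.classes.card := by
    unfold wsharp
    rw [Finset.sum_sub_distrib, Finset.sum_sub_distrib, Finset.mul_sum, Finset.sum_const, nsmul_eq_mul]
    ring
  rw [hw]
  nlinarith [hinv, hXq, hP₀, hsum]

end PLData

end PercRepro.SixFour
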